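import Literature.AnabelianGeometry.SemiGraphs.TemperedCoveringsSubgraph

/-!
# `B^temp(𝒢) ⥤ B^temp(𝒢_ℍ)` and transport of tempered fundamental groups along an equivalence ([SemiAnbd] §3 pp. 36–38) — DEFINITIONS

Mochizuki, *Semi-graphs of anabelioids*, Publ. RIMS **42** (2006), §3 Def. 3.5 (ii) p. 37
(`B^temp(𝒢) ⊆ B^cov(𝒢)`, tempered coverings) and p. 38 / Prop. 3.6 (ii) (a tempered fundamental
group `π₁^temp(𝒢)` is a tempered group `Π` with `B^temp(Π) ⥲ B^temp(𝒢)`)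
[cite: MochizukiSemiAnbd2006, Def 3.5(ii) p.37]; Mochizuki, *Inter-universal Teichmüller theory I*,
§2 p. 44: "the omission of cuspidal edges clearly does not affect … the tempered … fundamental
groups" [cite: Mochizuki2012, §2 p.44].

Sequel to `TemperedCoveringsSubgraph.lean` (abc-iut row W4-30 part 2; DEFINITIONS + the lemmas
they need):

* `CovObj.IsTempered.covRestrict` — temperedness passes to the restriction `S|_ℍ` to ANY
  sub-semi-graph (components refine; splitting finite coverings restrict), with its lemmas
  (`sameComponent_pointOfRestrict`, `splitsAt_covRestrict_iff`, …);
* `btempRestrict H : BTempCat 𝒢 ⥤ BTempCat (𝒢.restrict H)` — the restriction functor on `B^temp`;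
* `TemperedPiChart.transport` — a tempered fundamental group of `𝒢` is one of `𝒢'` along any
  equivalence `B^temp(𝒢') ≌ B^temp(𝒢)`, WITH THE SAME UNDERLYING TOPOLOGICAL GROUP (the form in
  which "`Π^tp` is unchanged" is consumed; the equivalence for a cusp omission is proved in the
  proof-only companion `TemperedCuspOmission.lean`).

Nothing here takes a side on [IUTchIII] Cor. 3.12; no fact is asserted.
-/

namespace Literature.AnabelianGeometry.SemiGraphs

namespace ProfiniteSemiGraph

open CategoryTheory

universe u

variable {𝒢 : ProfiniteSemiGraph.{u}} {H : 𝒢.graph.Subgraph}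

/-! ### Temperedness passes to the restriction (any sub-semi-graph) -/

namespace CovObj

/-- Finite objects restrict to finite objects. [cite: MochizukiSemiAnbd2006, §3 p.37] -/
theorem IsFinite.covRestrict {S : CovObj 𝒢} (h : S.IsFinite) (H : 𝒢.graph.Subgraph) :
    ((𝒢.covRestrict H).obj S).IsFinite :=
  ⟨fun v => h.finite_V v.1, fun e => h.finite_E e.1⟩

/-- Objects with nonempty fibres restrict to such. [cite: MochizukiSemiAnbd2006, §3 p.37] -/
theorem HasNonemptyFibres.covRestrict {S : CovObj 𝒢} (h : S.HasNonemptyFibres)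
    (H : 𝒢.graph.Subgraph) : ((𝒢.covRestrict H).obj S).HasNonemptyFibres :=
  ⟨fun v => h.nonempty_V v.1, fun e => h.nonempty_E e.1⟩

/-- Adjacency in `S|_ℍ` is adjacency in `S`. [cite: MochizukiSemiAnbd2006, Def 3.5(ii) p.37] -/
theorem adj_pointOfRestrict {S : CovObj 𝒢} {p q : ((𝒢.covRestrict H).obj S).Point}
    (h : ((𝒢.covRestrict H).obj S).Adj p q) : S.Adj (S.pointOfRestrict p) (S.pointOfRestrict q) := by
  cases h with
  | vertex v g x => exact Adj.vertex v.1 g x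
  | edge e g x => exact Adj.edge e.1 g x
  | glue b v h x => exact Adj.glue b.1 v.1 ((H.abuts_eq_some_iff b v).mp h) x

/-- Connected components of `S|_ℍ` map into connected components of `S`.
[cite: MochizukiSemiAnbd2006, Def 3.5(ii) p.37] -/
theorem sameComponent_pointOfRestrict {S : CovObj 𝒢} {p q : ((𝒢.covRestrict H).obj S).Point}
    (h : ((𝒢.covRestrict H).obj S).SameComponent p q) :
    S.SameComponent (S.pointOfRestrict p) (S.pointOfRestrict q) := by
  induction h with
  | rel _ _ h => exact Relation.EqvGen.rel _ _ (adj_pointOfRestrict h)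
  | refl _ => exact Relation.EqvGen.refl _
  | symm _ _ _ ih => exact Relation.EqvGen.symm _ _ ih
  | trans _ _ _ _ _ ih₁ ih₂ => exact Relation.EqvGen.trans _ _ _ ih₁ ih₂

/-- Splitting at a point of `S|_ℍ` is splitting at the corresponding point of `S`.
[cite: MochizukiSemiAnbd2006, Def 3.5(ii) p.37] -/
theorem splitsAt_covRestrict_iff {F S : CovObj 𝒢} (q : ((𝒢.covRestrict H).obj S).Point) :
    ((𝒢.covRestrict H).obj F).SplitsAt ((𝒢.covRestrict H).obj S) q ↔
      F.SplitsAt S (S.pointOfRestrict q) := by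
  rcases q with ⟨v, s⟩ | ⟨e, s⟩ <;> exact Iff.rfl

/-- **Temperedness passes to the restriction to any sub-semi-graph** (components refine, the
splitting finite coverings restrict). [cite: MochizukiSemiAnbd2006, Def 3.5(ii) p.37] -/
theorem IsTempered.covRestrict {S : CovObj 𝒢} (hS : S.IsTempered) (H : 𝒢.graph.Subgraph) :
    ((𝒢.covRestrict H).obj S).IsTempered := by
  intro p
  obtain ⟨F, hF, hFne, hsplit⟩ := hS (S.pointOfRestrict p)
  refine ⟨(𝒢.covRestrict H).obj F, hF.covRestrict H, hFne.covRestrict H, fun q hpq => ?_⟩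
  exact (splitsAt_covRestrict_iff q).mpr (hsplit _ (sameComponent_pointOfRestrict hpq))

end CovObj

/-! ### The restriction functor on `B^temp` -/

variable (𝒢) in
/-- **`B^temp(𝒢) ⥤ B^temp(𝒢_ℍ)`**: restriction of tempered coverings to a sub-semi-graph (the
restriction of a tempered object is tempered, `CovObj.IsTempered.covRestrict`).
[cite: MochizukiSemiAnbd2006, Def 3.5(ii) p.37] -/
noncomputable def btempRestrict (H : 𝒢.graph.Subgraph) : BTempCat 𝒢 ⥤ BTempCat (𝒢.restrict H) :=
  ObjectProperty.lift _ (ObjectProperty.ι _ ⋙ 𝒢.covRestrict H) fun S => S.property.covRestrict H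

/-- `btempRestrict` is `covRestrict` on underlying objects (definitional).
[cite: MochizukiSemiAnbd2006, Def 3.5(ii) p.37] -/
theorem btempRestrict_obj (H : 𝒢.graph.Subgraph) (S : BTempCat 𝒢) :
    ((𝒢.btempRestrict H).obj S).obj = (𝒢.covRestrict H).obj S.obj := rfl

/-- `btempRestrict ⋙ ι = ι ⋙ covRestrict` (definitional). [cite: MochizukiSemiAnbd2006, Def 3.5(ii) p.37] -/
theorem btempRestrict_comp_ι (H : 𝒢.graph.Subgraph) :
    𝒢.btempRestrict H ⋙ ObjectProperty.ι _ = ObjectProperty.ι _ ⋙ 𝒢.covRestrict H := rfl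

/-! ### Transport of tempered fundamental groups along an equivalence of `B^temp`'s -/

/-- **Transport of a tempered fundamental group**: a chart `(Π, B^temp(𝒢) ≌ B^temp(Π))` of `𝒢` and
an equivalence `B^temp(𝒢') ≌ B^temp(𝒢)` give a chart of `𝒢'` with THE SAME tempered group `Π`
([SemiAnbd] p. 38: `π₁^temp` is determined by `B^temp` up to inner automorphism, Prop. 3.2 /
Prop. 3.6 (ii)). [cite: MochizukiSemiAnbd2006, Prop 3.6(ii) p.38] -/
def TemperedPiChart.transport {𝒢 𝒢' : ProfiniteSemiGraph.{u}} (c : TemperedPiChart 𝒢)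
    (e : BTempCat 𝒢' ≌ BTempCat 𝒢) : TemperedPiChart 𝒢' where
  G := c.G
  isTempered := c.isTempered
  secondCountableTopology := c.secondCountableTopology
  equiv := e.trans c.equiv

/-- The transported chart has the same underlying group (definitional).
[cite: MochizukiSemiAnbd2006, Prop 3.6(ii) p.38] -/
theorem TemperedPiChart.transport_G {𝒢 𝒢' : ProfiniteSemiGraph.{u}} (c : TemperedPiChart 𝒢)
    (e : BTempCat 𝒢' ≌ BTempCat 𝒢) : (c.transport e).G = c.G := rfl

/-- The transported chart's equivalence is the composite (definitional).
[cite: MochizukiSemiAnbd2006, Prop 3.6(ii) p.38] -/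
theorem TemperedPiChart.transport_equiv {𝒢 𝒢' : ProfiniteSemiGraph.{u}} (c : TemperedPiChart 𝒢)
    (e : BTempCat 𝒢' ≌ BTempCat 𝒢) : (c.transport e).equiv = e.trans c.equiv := rfl

end ProfiniteSemiGraph

end Literature.AnabelianGeometry.SemiGraphs
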